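import Summits.BirchSwinnertonDyer.Rank1Residual.P2.CongruentClassSevenConfigTransfer
import Summits.BirchSwinnertonDyer.Rank1Residual.P2.GenusSumsThreePrimes
import Summits.BirchSwinnertonDyer.Rank1Residual.P2.CongruentNumberPairsAtTwoPrimeSevenModEight
import HarnessLib

/-!
# Sub-lane «bsd-p2»: in class `n ≡ 7 (mod 8)` with three prime factors, the Faulkner–James kernel
# condition `#NS(L(G(−n))) = 4` IMPLIES the genus condition of Tian–Yuan–Zhang Thm 1.2
# (the `hgen`-free door for `ω(n) = 3`; WAKE-theoremU of p2-lead ML-42, W1′)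

HONEST FRAMING (sub-lane «bsd-p2», run/shared/lean/b2b/bsd-rank1-residual/p2/, verbatim in every
file): the target of record is the FULL Birch–Swinnerton-Dyer formula for EVERY analytic-rank `≤ 1`
`E/ℚ` at ALL primes INCLUDING `2`; the odd-prime class ledger is referee A's; the `2`-part is OPEN
(cells O1 = X5 ∖ CM and O12 = the CM corner) and under census by «bsd-p2». Census / instrument
output at `2` = EVIDENCE / conjecture items with held-out validation, NEVER a Literature fact;
certificates close PAIRS (one isogeny class, `p = 2`), never classes. This file asserts NO
arithmetic fact: every journal input is DISPLAYED as a hypothesis (`hR` = Rédei–Reichardt as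
vendored in `RedeiMatrixFourRank.lean`; in the door corollary also `h12` = TYZ Thm 1.2, `hGZK`,
`hM` = Monsky 1994), and everything else is PROVED.

WHAT IT DOES. p2-idea-2's desk theorem "O-ρG" (`p2/idea-2/O-rhoG-NOTE.md` v0.4 §8–§9; dictionary
countersigned in `p2/monsky/lit/A44-REDEI-GRAPH-COUNTERSIGN.md`) at `ω(n) = 3`: for `n = p₀p₁p₂ ≡ 7 (mod 8)`
the Faulkner–James count `#NS(L(G(−n))) = 4` (= TYZ's `ρ(n) = 0` via `rhoIndex_eq_one_of_card_ker`) already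
forces TYZ's genus condition. No matrix-tree theorem is used: `fjLaplacianNeg p`, every `g(d) mod 2`
(`d ∣ n`, modulo `hR`) and both genus sums are PROVED to be functions of the Legendre configuration
(files `CongruentClassSevenConfigTransfer`, `GenusSumsThreePrimes`; quadratic reciprocity =
`kroneckerBit_swap`), and the implication is decided on the `128` configurations (`66` have `#NS = 4`).
ERRATUM F-Σ2 / p2-lead T-81 (RULING A47, 2026-08-22): the tree's `genusSum₂` omits the `ℓ = 0` term `{n}`
of TYZ's printed second sum; `thm12_parity_of_scriptL` is MIS-STATED, superseded by lit-1's
`thm12_parity_of_scriptL'` / `genusSum₂'` (p328335; `genusSum₂'_eq_genusSum₂_add_self : Σ₂′ = Σ₂ + g(n)`).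
THIS FILE PROVES BOTH READINGS: `odd_genusSum_of_card_ker_fjLaplacianNeg_three` (`Σ₁` odd ∨ tree-`Σ₂`
odd; finite check `sigma_odd_of_card_ker_fjCfg_three` of file 1) and
`odd_genusSum_of_card_ker_fjLaplacianNeg_three'` (`Σ₁` odd ∨ PRINTED `Σ₂′` odd; second finite check
`sigma_odd_of_card_ker_fjCfg_three'` here — same `66` configurations, same `48 + 18` profile, the
`g(n)`-bit being `1` on the `48` and `0` on the `18`; p2-monsky-x GEN 7 cross-read). The `ω(n) = 3` FAMILY
DOOR `bsdp_two_congruentNumberCurve_of_card_ker_fj_three` (distinct primes, `p₀p₁p₂ ≡ 7 (mod 8)`, Monsky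
kernel `2`, FJ kernel `4` ⟹ `BSD(E_n, 2)` modulo ONLY `h12`, `hGZK`, `hM`, `hR`) goes, AS OF THIS FILE,
through the typer's door `bsdp_two_congruentNumberCurve_of_genus'` keyed on the MIS-STATED `h12` and is
fed the tree-`Σ₂` lemma — RE-KEY PENDING (T-81): once the primed door (`thm12_parity_of_scriptL'`, genus
input `Σ₁` odd ∨ `Σ₂′` odd) lands, the primed corollary is ONE append feeding it the primed lemma.
Nothing booked; no mark moved. Five-file series (see `CongruentClassSevenConfigurations`); unit
`b2b-bsdres-p2-monsky-lit` GEN 7; NEW file.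

References: [TianYuanZhang2017] Thm 1.2, §1, Cor. 1.4, Prop. 3.4; [LiMa2008] Lemma 0.1, Def. 0.2, Thm 0.4;
[FaulknerJames2007] Def. 1.5, Thm 1.2 (2), Lemma 5.1; [Smith2016CongruentDensity] arXiv:1603.08479 §2 Table 1;
[IrelandRosen1990] Prop. 5.1.2, Thm 5.1; HOME/p2/idea-2/O-rhoG-NOTE.md v0.4; HOME/p2/LEAD-OKS.md ML-42, T-81.
-/

open Matrix Finset NumberField Literature.NumberTheory.EllipticCurves
  Literature.NumberTheory.EllipticCurves.HeathBrown1994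
  Literature.NumberTheory.EllipticCurves.TianYuanZhang2017
  Literature.NumberTheory.EllipticCurves.FaulknerJames2007
  Literature.NumberTheory.QuadraticFields.RedeiReichardt

set_option autoImplicit false

namespace Summit.BirchSwinnertonDyer.Rank1Residual.P2

/-! ## §6 Assembly: the `hgen`-free lemma for `ω(n) = 3`, and the family door -/

section Assembly

/-- `[(q/q)]`-bit is `0` (the symbol vanishes; Euler's power `0^{(q−1)/2} ≡ 0 ≢ −1`).
[cite: IrelandRosen1990, Ch. 5 §1 Prop. 5.1.2] -/
theorem kroneckerBit_self {q : ℕ} (hq : q.Prime) : kroneckerBit q q = 0 := by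
  unfold kroneckerBit
  by_cases h2 : q = 2
  · subst h2; decide
  · rw [if_neg h2, Int.emod_self, Int.toNat_zero, zero_pow (Nat.div_pos hq.two_le two_pos).ne',
      Nat.zero_mod, if_neg]
    have := hq.two_le
    omega

/-- Residues mod `8` multiply. [cite: HardyWright2008, §5.2] -/
theorem mod_eight_mul_three (x y z : ℕ) : (x % 8 * (y % 8) * (z % 8)) % 8 = (x * y * z) % 8 :=
  ((Nat.mod_modEq x 8).mul (Nat.mod_modEq y 8)).mul (Nat.mod_modEq z 8)

/-- `pat₂` through residues of a product. [cite: TianYuanZhang2017, Thm. 1.2 (Σ₂)] -/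
theorem pat₂_mod_mul (x y z : ℕ) : pat₂ (x % 8) (y % 8 * (z % 8)) = pat₂ x (y * z) := by
  unfold pat₂
  rw [Nat.mod_mod, ← Nat.mul_mod]

set_option maxHeartbeats 400000 in
/-- **The finite check (`ω(n) = 3`) for TYZ's second sum AS PRINTED** (ERRATUM F-Σ2 / p2-lead T-81).
For every Legendre configuration of three odd primes with `p₀p₁p₂ ≡ 7 (mod 8)`: if the Faulkner–James
Laplacian has exactly `4` null vectors then the `Σ₁`-bit is `1` or the `Σ₂′`-bit — `sigma2Cfg` PLUS the
`g(n)`-bit `gBitSub ![0, 1, 2]` of the `ℓ = 0` term (`genusSum₂'_eq_genusSum₂_add_self`) — is `1`. The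
same `66` configurations as `sigma_odd_of_card_ker_fjCfg_three`; on its `48` with `Σ₁`-bit `1` the
`g(n)`-bit is `1`, on the other `18` it is `0`, so the outcome profile `48 + 18` is unchanged
(p2-monsky-x GEN 7, `SIGMA2-XREAD-config-k3.json`; `p2/monsky/lit/w1/w1_sigma2prime_check.py`). `decide`.
[cite: TianYuanZhang2017, Thm. 1.2 (as printed) and proof of Prop. 3.4 (p0016 L146)] [cite: FaulknerJames2007, Thm. 1.2 (2)] -/
theorem sigma_odd_of_card_ker_fjCfg_three' :
    ∀ (r₀ r₁ r₂ : Fin 8) (s₀ s₁ s₂ : ZMod 2),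
      (r₀.val % 2 = 1 ∧ r₁.val % 2 = 1 ∧ r₂.val % 2 = 1) →
      (r₀.val * r₁.val * r₂.val) % 8 = 7 →
      Fintype.card {v : Fin 4 → ZMod 2 //
        fjCfg ![r₀.val, r₁.val, r₂.val] (betaOf ![r₀.val, r₁.val, r₂.val] ![s₀, s₁, s₂]) *ᵥ v = 0} = 4 →
      sigma1Cfg ![r₀.val, r₁.val, r₂.val] (betaOf ![r₀.val, r₁.val, r₂.val] ![s₀, s₁, s₂]) = 1 ∨
      sigma2Cfg ![r₀.val, r₁.val, r₂.val] (betaOf ![r₀.val, r₁.val, r₂.val] ![s₀, s₁, s₂])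
        + gBitSub ![0, 1, 2] ![r₀.val, r₁.val, r₂.val]
            (betaOf ![r₀.val, r₁.val, r₂.val] ![s₀, s₁, s₂]) = 1 := by
  decide

variable (p : Fin 3 → ℕ)

/-- **`Σ₁ mod 2` of `n = p₀p₁p₂` equals `sigma1Cfg` of the configuration** (modulo `hR`).
[cite: TianYuanZhang2017, Thm. 1.2 (Σ₁)] [cite: LiMa2008, Thm. 0.4] -/
theorem sigma1Cfg_eq_natCast_genusSum₁ (hR : redeiReichardt_fourTwoCard_classGroup)
    (hp : ∀ i, (p i).Prime) (hp2 : ∀ i, p i ≠ 2) (hinj : Function.Injective p) :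
    sigma1Cfg (fun i => p i % 8) (fun a b => kroneckerBit (p b) (p a)) =
      ((genusSum₁ (p 0 * p 1 * p 2) (fun d => genusClassNumber (GenusField d)) : ℕ) : ZMod 2) := by
  have h01 : p 0 ≠ p 1 := fun h => absurd (hinj h) (by decide)
  have h02 : p 0 ≠ p 2 := fun h => absurd (hinj h) (by decide)
  have h12 : p 1 ≠ p 2 := fun h => absurd (hinj h) (by decide)
  have G012 := natCast_genusClassNumber_eq_gBitSub hR p hp hp2 hinj ![0, 1, 2] (by decide)
  have G0 := natCast_genusClassNumber_eq_gBitSub hR p hp hp2 hinj ![0] (by decide)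
  have G1 := natCast_genusClassNumber_eq_gBitSub hR p hp hp2 hinj ![1] (by decide)
  have G2 := natCast_genusClassNumber_eq_gBitSub hR p hp hp2 hinj ![2] (by decide)
  have G12 := natCast_genusClassNumber_eq_gBitSub hR p hp hp2 hinj ![1, 2] (by decide)
  have G02 := natCast_genusClassNumber_eq_gBitSub hR p hp hp2 hinj ![0, 2] (by decide)
  have G01 := natCast_genusClassNumber_eq_gBitSub hR p hp hp2 hinj ![0, 1] (by decide)
  have e012 : (∏ i : Fin 3, p ((![0, 1, 2] : Fin 3 → Fin 3) i)) = p 0 * p 1 * p 2 := by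
    rw [Fin.prod_univ_three]; rfl
  have e0 : (∏ i : Fin 1, p ((![0] : Fin 1 → Fin 3) i)) = p 0 := by rw [Fin.prod_univ_one]; rfl
  have e1 : (∏ i : Fin 1, p ((![1] : Fin 1 → Fin 3) i)) = p 1 := by rw [Fin.prod_univ_one]; rfl
  have e2 : (∏ i : Fin 1, p ((![2] : Fin 1 → Fin 3) i)) = p 2 := by rw [Fin.prod_univ_one]; rfl
  have e12 : (∏ i : Fin 2, p ((![1, 2] : Fin 2 → Fin 3) i)) = p 1 * p 2 := by
    rw [Fin.prod_univ_two]; rfl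
  have e02 : (∏ i : Fin 2, p ((![0, 2] : Fin 2 → Fin 3) i)) = p 0 * p 2 := by
    rw [Fin.prod_univ_two]; rfl
  have e01 : (∏ i : Fin 2, p ((![0, 1] : Fin 2 → Fin 3) i)) = p 0 * p 1 := by
    rw [Fin.prod_univ_two]; rfl
  rw [e012] at G012
  rw [e0] at G0
  rw [e1] at G1
  rw [e2] at G2
  rw [e12] at G12
  rw [e02] at G02
  rw [e01] at G01
  rw [natCast_genusSum₁_three _ (hp 0) (hp 1) (hp 2) h01 h02 h12]
  unfold sigma1Cfg
  rw [← G012, ← G0, ← G1, ← G2, ← G12, ← G02, ← G01]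
  simp only [Nat.mod_mod, ← Nat.mul_mod]

/-- **`Σ₂ mod 2` of `n = p₀p₁p₂` equals `sigma2Cfg` of the configuration** (modulo `hR`).
[cite: TianYuanZhang2017, Thm. 1.2 (Σ₂)] [cite: LiMa2008, Thm. 0.4] -/
theorem sigma2Cfg_eq_natCast_genusSum₂ (hR : redeiReichardt_fourTwoCard_classGroup)
    (hp : ∀ i, (p i).Prime) (hp2 : ∀ i, p i ≠ 2) (hinj : Function.Injective p) :
    sigma2Cfg (fun i => p i % 8) (fun a b => kroneckerBit (p b) (p a)) =
      ((genusSum₂ (p 0 * p 1 * p 2) (fun d => genusClassNumber (GenusField d)) : ℕ) : ZMod 2) := by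
  have h01 : p 0 ≠ p 1 := fun h => absurd (hinj h) (by decide)
  have h02 : p 0 ≠ p 2 := fun h => absurd (hinj h) (by decide)
  have h12 : p 1 ≠ p 2 := fun h => absurd (hinj h) (by decide)
  have G0 := natCast_genusClassNumber_eq_gBitSub hR p hp hp2 hinj ![0] (by decide)
  have G1 := natCast_genusClassNumber_eq_gBitSub hR p hp hp2 hinj ![1] (by decide)
  have G2 := natCast_genusClassNumber_eq_gBitSub hR p hp hp2 hinj ![2] (by decide)
  have G12 := natCast_genusClassNumber_eq_gBitSub hR p hp hp2 hinj ![1, 2] (by decide)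
  have G02 := natCast_genusClassNumber_eq_gBitSub hR p hp hp2 hinj ![0, 2] (by decide)
  have G01 := natCast_genusClassNumber_eq_gBitSub hR p hp hp2 hinj ![0, 1] (by decide)
  have e0 : (∏ i : Fin 1, p ((![0] : Fin 1 → Fin 3) i)) = p 0 := by rw [Fin.prod_univ_one]; rfl
  have e1 : (∏ i : Fin 1, p ((![1] : Fin 1 → Fin 3) i)) = p 1 := by rw [Fin.prod_univ_one]; rfl
  have e2 : (∏ i : Fin 1, p ((![2] : Fin 1 → Fin 3) i)) = p 2 := by rw [Fin.prod_univ_one]; rfl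
  have e12 : (∏ i : Fin 2, p ((![1, 2] : Fin 2 → Fin 3) i)) = p 1 * p 2 := by
    rw [Fin.prod_univ_two]; rfl
  have e02 : (∏ i : Fin 2, p ((![0, 2] : Fin 2 → Fin 3) i)) = p 0 * p 2 := by
    rw [Fin.prod_univ_two]; rfl
  have e01 : (∏ i : Fin 2, p ((![0, 1] : Fin 2 → Fin 3) i)) = p 0 * p 1 := by
    rw [Fin.prod_univ_two]; rfl
  rw [e0] at G0
  rw [e1] at G1
  rw [e2] at G2
  rw [e12] at G12
  rw [e02] at G02
  rw [e01] at G01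
  rw [natCast_genusSum₂_three _ (hp 0) (hp 1) (hp 2) h01 h02 h12]
  unfold sigma2Cfg
  rw [← G0, ← G1, ← G2, ← G12, ← G02, ← G01, pat₂_mod_mul, pat₂_mod_mul, pat₂_mod_mul, pat₃_mod]

/-- **Printed `Σ₂′ mod 2` of `n = p₀p₁p₂ ≡ 5, 6, 7 (mod 8)` equals `sigma2Cfg` plus the `g(n)`-bit of the
configuration** (modulo `hR`; ERRATUM F-Σ2: `genusSum₂'`, WITH the `ℓ = 0` term).
[cite: TianYuanZhang2017, Thm. 1.2 (Σ₂, as printed) and proof of Prop. 3.4 (p0016 L146)] [cite: LiMa2008, Thm. 0.4] -/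
theorem sigma2Cfg_add_gBitSub_eq_natCast_genusSum₂' (hR : redeiReichardt_fourTwoCard_classGroup)
    (hp : ∀ i, (p i).Prime) (hp2 : ∀ i, p i ≠ 2) (hinj : Function.Injective p)
    (h8 : (p 0 * p 1 * p 2) % 8 = 5 ∨ (p 0 * p 1 * p 2) % 8 = 6 ∨ (p 0 * p 1 * p 2) % 8 = 7) :
    sigma2Cfg (fun i => p i % 8) (fun a b => kroneckerBit (p b) (p a))
      + gBitSub ![0, 1, 2] (fun i => p i % 8) (fun a b => kroneckerBit (p b) (p a)) =
      ((genusSum₂' (p 0 * p 1 * p 2) (fun d => genusClassNumber (GenusField d)) : ℕ) : ZMod 2) := by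
  have G012 := natCast_genusClassNumber_eq_gBitSub hR p hp hp2 hinj ![0, 1, 2] (by decide)
  have e012 : (∏ i : Fin 3, p ((![0, 1, 2] : Fin 3 → Fin 3) i)) = p 0 * p 1 * p 2 := by
    rw [Fin.prod_univ_three]; rfl
  rw [e012] at G012
  have h1 : 1 < p 0 * p 1 * p 2 :=
    (hp 0).one_lt.trans_le
      ((Nat.le_mul_of_pos_right (p 0) (hp 1).pos).trans (Nat.le_mul_of_pos_right _ (hp 2).pos))
  rw [genusSum₂'_eq_genusSum₂_add_self h1 h8, Nat.cast_add, ← sigma2Cfg_eq_natCast_genusSum₂ p hR hp hp2 hinj,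
    G012]

/-- No prime factor of `n ≡ 7 (mod 8)` is `2`. [cite: HardyWright2008, §5.2] -/
theorem ne_two_of_prod_eq {n : ℕ} (hn : ∏ i, p i = n) (h8 : n % 8 = 7) (i : Fin 3) : p i ≠ 2 := by
  intro hi
  have h2n : p i ∣ n := hn ▸ Finset.dvd_prod_of_mem p (Finset.mem_univ i)
  rw [hi] at h2n
  omega

/-- **Both finite checks pulled back to an actual prime triple.** For distinct primes `p₀ p₁ p₂` with
`p₀p₁p₂ ≡ 7 (mod 8)` and FJ kernel count `4`, the configuration of `p` (residues `pᵢ mod 8`, bits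
`[(p_b/p_a) = −1]`; the transposed bits agree with `betaOf` by quadratic reciprocity, `kroneckerBit_swap`)
satisfies the conclusions of `sigma_odd_of_card_ker_fjCfg_three` (tree `Σ₂`) and of
`sigma_odd_of_card_ker_fjCfg_three'` (printed `Σ₂′`). [cite: FaulknerJames2007, Thm. 1.2 (2), Def. 1.5]
[cite: IrelandRosen1990, Ch. 5 §2 Thm. 1 (quadratic reciprocity)] -/
theorem sigmaCfg_of_card_ker_fjLaplacianNeg_three (hp : ∀ i, (p i).Prime)
    (hinj : Function.Injective p) {n : ℕ} (hn : ∏ i, p i = n) (h8 : n % 8 = 7)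
    (hker : Fintype.card {v : Fin (3 + 1) → ZMod 2 // fjLaplacianNeg p *ᵥ v = 0} = 4) :
    (sigma1Cfg (fun i => p i % 8) (fun a b => kroneckerBit (p b) (p a)) = 1 ∨
      sigma2Cfg (fun i => p i % 8) (fun a b => kroneckerBit (p b) (p a)) = 1) ∧
    (sigma1Cfg (fun i => p i % 8) (fun a b => kroneckerBit (p b) (p a)) = 1 ∨
      sigma2Cfg (fun i => p i % 8) (fun a b => kroneckerBit (p b) (p a))
        + gBitSub ![0, 1, 2] (fun i => p i % 8) (fun a b => kroneckerBit (p b) (p a)) = 1) := by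
  have hn3 : n = p 0 * p 1 * p 2 := by rw [← hn, Fin.prod_univ_three]
  have hp2 := ne_two_of_prod_eq p hn h8
  have h01 : p 0 ≠ p 1 := fun h => absurd (hinj h) (by decide)
  have h02 : p 0 ≠ p 2 := fun h => absurd (hinj h) (by decide)
  have h12 : p 1 ≠ p 2 := fun h => absurd (hinj h) (by decide)
  -- the configuration, packaged for the finite theorems
  set r₀ : Fin 8 := ⟨p 0 % 8, Nat.mod_lt _ (by norm_num)⟩ with hr₀
  set r₁ : Fin 8 := ⟨p 1 % 8, Nat.mod_lt _ (by norm_num)⟩ with hr₁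
  set r₂ : Fin 8 := ⟨p 2 % 8, Nat.mod_lt _ (by norm_num)⟩ with hr₂
  have hRfun : (fun i => p i % 8) = ![r₀.val, r₁.val, r₂.val] := by
    funext i; fin_cases i <;> rfl
  have hBfun : (fun a b => kroneckerBit (p b) (p a)) =
      betaOf ![r₀.val, r₁.val, r₂.val] ![kroneckerBit (p 1) (p 0), kroneckerBit (p 2) (p 0),
        kroneckerBit (p 2) (p 1)] := by
    funext a b
    fin_cases a <;> fin_cases b
    · simpa [betaOf] using kroneckerBit_self (hp 0)
    · simp [betaOf]
    · simp [betaOf]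
    · simp [betaOf, hr₀, hr₁, chi4Bit_mod_eight, kroneckerBit_swap (hp 0) (hp 1) (hp2 0) (hp2 1) h01,
        mul_comm]
    · simpa [betaOf] using kroneckerBit_self (hp 1)
    · simp [betaOf]
    · simp [betaOf, hr₀, hr₂, chi4Bit_mod_eight, kroneckerBit_swap (hp 0) (hp 2) (hp2 0) (hp2 2) h02,
        mul_comm]
    · simp [betaOf, hr₁, hr₂, chi4Bit_mod_eight, kroneckerBit_swap (hp 1) (hp 2) (hp2 1) (hp2 2) h12,
        mul_comm]
    · simpa [betaOf] using kroneckerBit_self (hp 2)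
  -- the kernel hypothesis, read on the configuration
  have hmat : fjLaplacianNeg p = fjCfg ![r₀.val, r₁.val, r₂.val]
      (betaOf ![r₀.val, r₁.val, r₂.val] ![kroneckerBit (p 1) (p 0), kroneckerBit (p 2) (p 0),
        kroneckerBit (p 2) (p 1)]) := by
    rw [fjLaplacianNeg_eq_fjCfg, hRfun, hBfun]
  have hcard : Fintype.card {v : Fin (3 + 1) → ZMod 2 // fjLaplacianNeg p *ᵥ v = 0} =
      Fintype.card {v : Fin 4 → ZMod 2 // fjCfg ![r₀.val, r₁.val, r₂.val]
        (betaOf ![r₀.val, r₁.val, r₂.val] ![kroneckerBit (p 1) (p 0), kroneckerBit (p 2) (p 0),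
          kroneckerBit (p 2) (p 1)]) *ᵥ v = 0} :=
    Fintype.card_congr (Equiv.subtypeEquivRight fun v => by rw [hmat])
  rw [hcard] at hker
  -- parity and product hypotheses of the finite theorems
  have hodd : ∀ i, p i % 2 = 1 := fun i => Nat.odd_iff.mp ((hp i).odd_of_ne_two (hp2 i))
  have h7 : (r₀.val * r₁.val * r₂.val) % 8 = 7 := by
    show (p 0 % 8 * (p 1 % 8) * (p 2 % 8)) % 8 = 7
    rw [mod_eight_mul_three, ← hn3, h8]
  have hpar : r₀.val % 2 = 1 ∧ r₁.val % 2 = 1 ∧ r₂.val % 2 = 1 := by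
    refine ⟨?_, ?_, ?_⟩
    · show p 0 % 8 % 2 = 1; have := hodd 0; omega
    · show p 1 % 8 % 2 = 1; have := hodd 1; omega
    · show p 2 % 8 % 2 = 1; have := hodd 2; omega
  have hfin := sigma_odd_of_card_ker_fjCfg_three r₀ r₁ r₂ (kroneckerBit (p 1) (p 0))
    (kroneckerBit (p 2) (p 0)) (kroneckerBit (p 2) (p 1)) hpar h7 hker
  have hfin' := sigma_odd_of_card_ker_fjCfg_three' r₀ r₁ r₂ (kroneckerBit (p 1) (p 0))
    (kroneckerBit (p 2) (p 0)) (kroneckerBit (p 2) (p 1)) hpar h7 hker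
  rw [← hBfun, ← hRfun] at hfin hfin'
  exact ⟨hfin, hfin'⟩

/-- **THE `hgen`-FREE LEMMA (`ω(n) = 3`), tree-`Σ₂` reading.** Modulo Rédei–Reichardt as displayed
(`hR`): for `n = p₀p₁p₂` (distinct primes) with `n ≡ 7 (mod 8)`, if the Faulkner–James Laplacian of
`G(−n)` has exactly `4` null vectors, then `Σ₁(n)` is odd or the tree's `Σ₂(n)` (`genusSum₂`, without the
`ℓ = 0` term) is odd — exactly the hypothesis `hgen` of the door `bsdp_two_congruentNumberCurve_of_genus(')`
AS CURRENTLY KEYED, now IMPLIED by its `ρ(n) = 0` certificate (p2-idea-2's THEOREM O-ρG at `k = 3`).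
[cite: TianYuanZhang2017, Thm. 1.2] [cite: FaulknerJames2007, Thm. 1.2 (2), Def. 1.5] [cite: LiMa2008, Thm. 0.4] -/
theorem odd_genusSum_of_card_ker_fjLaplacianNeg_three (hR : redeiReichardt_fourTwoCard_classGroup)
    (hp : ∀ i, (p i).Prime) (hinj : Function.Injective p) {n : ℕ} (hn : ∏ i, p i = n)
    (h8 : n % 8 = 7)
    (hker : Fintype.card {v : Fin (3 + 1) → ZMod 2 // fjLaplacianNeg p *ᵥ v = 0} = 4) :
    Odd (genusSum₁ n fun d => genusClassNumber (GenusField d)) ∨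
      Odd (genusSum₂ n fun d => genusClassNumber (GenusField d)) := by
  have hn3 : n = p 0 * p 1 * p 2 := by rw [← hn, Fin.prod_univ_three]
  have hp2 := ne_two_of_prod_eq p hn h8
  have h := (sigmaCfg_of_card_ker_fjLaplacianNeg_three p hp hinj hn h8 hker).1
  rw [sigma1Cfg_eq_natCast_genusSum₁ p hR hp hp2 hinj, sigma2Cfg_eq_natCast_genusSum₂ p hR hp hp2 hinj,
    ← hn3, ZMod.natCast_eq_one_iff_odd, ZMod.natCast_eq_one_iff_odd] at h
  exact h

/-- **THE `hgen`-FREE LEMMA (`ω(n) = 3`) FOR THM 1.2 AS PRINTED** (ERRATUM F-Σ2 / p2-lead T-81). Modulo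
Rédei–Reichardt as displayed (`hR`): for `n = p₀p₁p₂` (distinct primes) with `n ≡ 7 (mod 8)`, if the
Faulkner–James Laplacian of `G(−n)` has exactly `4` null vectors, then `Σ₁(n)` is odd or the PRINTED
second sum `Σ₂′(n)` (`genusSum₂'`, WITH the `ℓ = 0` term) is odd — the genus input of the primed doors of
the re-key wave (`thm12_parity_of_scriptL'`).
[cite: TianYuanZhang2017, Thm. 1.2 (as printed), proof of Prop. 3.4 (p0016 L146)] [cite: FaulknerJames2007, Thm. 1.2 (2), Def. 1.5] [cite: LiMa2008, Thm. 0.4] -/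
theorem odd_genusSum_of_card_ker_fjLaplacianNeg_three' (hR : redeiReichardt_fourTwoCard_classGroup)
    (hp : ∀ i, (p i).Prime) (hinj : Function.Injective p) {n : ℕ} (hn : ∏ i, p i = n)
    (h8 : n % 8 = 7)
    (hker : Fintype.card {v : Fin (3 + 1) → ZMod 2 // fjLaplacianNeg p *ᵥ v = 0} = 4) :
    Odd (genusSum₁ n fun d => genusClassNumber (GenusField d)) ∨
      Odd (genusSum₂' n fun d => genusClassNumber (GenusField d)) := by
  have hn3 : n = p 0 * p 1 * p 2 := by rw [← hn, Fin.prod_univ_three]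
  have hp2 := ne_two_of_prod_eq p hn h8
  have h8' : (p 0 * p 1 * p 2) % 8 = 5 ∨ (p 0 * p 1 * p 2) % 8 = 6 ∨ (p 0 * p 1 * p 2) % 8 = 7 :=
    Or.inr (Or.inr (hn3 ▸ h8))
  have h := (sigmaCfg_of_card_ker_fjLaplacianNeg_three p hp hinj hn h8 hker).2
  rw [sigma1Cfg_eq_natCast_genusSum₁ p hR hp hp2 hinj,
    sigma2Cfg_add_gBitSub_eq_natCast_genusSum₂' p hR hp hp2 hinj h8', ← hn3, ZMod.natCast_eq_one_iff_odd,
    ZMod.natCast_eq_one_iff_odd] at h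
  exact h

/-- **THE `ω(n) = 3` FAMILY DOOR at `p = 2` (class `n ≡ 7 (mod 8)`).** For ALL distinct primes
`p₀, p₁, p₂` with `p₀p₁p₂ ≡ 7 (mod 8)`: if Monsky's matrix (Heath-Brown 1994 appendix; the door's
`hker`, built from the additive Legendre data `L, d2, dm2`) has a `2`-element kernel (`s(n) = 1`) and
the Faulkner–James Laplacian of `G(−n)` has a `4`-element kernel, then `BSD(E_n, 2)` holds for
`E_n : y² = x³ − n²x`, `n = p₀p₁p₂` — modulo ONLY the displayed journal facts `h12` (TYZ Thm 1.2),
`hGZK` (Gross–Zagier–Kolyvagin, rank part), `hM` (Monsky's `#Sel₂` formula), `hR` (Rédei–Reichardt).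
Torsion `#E_n(ℚ)_tor = 4` and `∏ c_ℓ = 2⁷` are lit-1's theorems; `ρ(n) = 0` is p2-monsky-lit's
`rhoIndex_eq_one_of_card_ker`; the genus condition is §6's lemma — NO `hgen`, NO L-value.
READING / RE-KEY PENDING (ERRATUM F-Σ2, p2-lead T-81): this corollary goes through the typer's door
`bsdp_two_congruentNumberCurve_of_genus'`, keyed on `h12 : thm12_parity_of_scriptL` — MIS-STATED (its `Σ₂`
clause omits the `ℓ = 0` term; superseded by `thm12_parity_of_scriptL'`) — and feeds it the TREE-`Σ₂`
lemma `odd_genusSum_of_card_ker_fjLaplacianNeg_three`; the mathematics survives the repair because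
`odd_genusSum_of_card_ker_fjLaplacianNeg_three'` gives `Σ₁` odd ∨ PRINTED `Σ₂′` odd under the same
hypotheses, so the primed corollary over the primed door is one append in the re-key wave.
[cite: TianYuanZhang2017, Thm. 1.2 and §1 (1.1)] [cite: FaulknerJames2007, Thm. 1.2 (2)]
[cite: HeathBrown1994SelmerCongruentII, Appendix (Monsky)] [cite: Miller2011LMS, Def. 1.1 (arXiv:1010.2431 p. 3)] -/
theorem bsdp_two_congruentNumberCurve_of_card_ker_fj_three (h12 : thm12_parity_of_scriptL)
    (hGZK : rank_eq_analyticRank_of_analyticRank_le_one) (hM : monsky_card_selmerGroup_two_odd)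
    (hR : redeiReichardt_fourTwoCard_classGroup)
    (hp : ∀ i, (p i).Prime) (hinj : Function.Injective p) {n : ℕ} (hn : ∏ i, p i = n)
    (h8 : n % 8 = 7) (L : Fin 3 → Fin 3 → ZMod 2) (d2 dm2 : Fin 3 → ZMod 2)
    (hL : ∀ i j, addLegendreSym (p j) (p i) = L i j) (h2 : ∀ i, addLegendreSym 2 (p i) = d2 i)
    (hm2 : ∀ i, addLegendreSym (-2) (p i) = dm2 i)
    (hkerM : Fintype.card {v : Fin 3 ⊕ Fin 3 → ZMod 2 // Matrix.fromBlocks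
        (Matrix.of (fun i j => if i = j then ∑ l ∈ Finset.univ.erase i, L i l else L i j) +
          Matrix.diagonal d2) (Matrix.diagonal d2) (Matrix.diagonal d2)
        (Matrix.of (fun i j => if i = j then ∑ l ∈ Finset.univ.erase i, L i l else L i j) +
          Matrix.diagonal dm2) *ᵥ v = 0} = 2)
    (hkerFJ : Fintype.card {v : Fin (3 + 1) → ZMod 2 // fjLaplacianNeg p *ᵥ v = 0} = 4) :
    BSDp (congruentNumberCurve n) 2 := by
  have hodd : ∀ i, Odd (p i) := fun i => (hp i).odd_of_ne_two (ne_two_of_prod_eq p hn h8 i)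
  have h8' : (∏ i, p i) % 8 = 1 ∨ (∏ i, p i) % 8 = 7 := Or.inr (by rw [hn]; exact h8)
  exact bsdp_two_congruentNumberCurve_of_genus' p h12 hGZK hM hp hodd hinj hn (Or.inr h8) L d2 dm2
    hL h2 hm2 hkerM (rhoIndex_eq_one_of_card_ker p hp hinj h8' hkerFJ hn)
    (odd_genusSum_of_card_ker_fjLaplacianNeg_three p hR hp hinj hn h8 hkerFJ)

/-- **THE `ω(n) = 3` FAMILY DOOR at `p = 2`, RE-KEYED TO TYZ Thm 1.2 AS PRINTED** (twin of
`bsdp_two_congruentNumberCurve_of_card_ker_fj_three` with `h12 : thm12_parity_of_scriptL'`; the re-key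
append of p2-lead T-81 / ML-55 'W7').  Same hypotheses, same term, through the typer's primed door
`bsdp_two_congruentNumberCurve_of_genus''` (genus input `Σ₁` odd ∨ PRINTED `Σ₂′` odd) fed by
`odd_genusSum_of_card_ker_fjLaplacianNeg_three'`: for ALL distinct primes `p₀, p₁, p₂` with
`p₀p₁p₂ ≡ 7 (mod 8)`, a `2`-element kernel of Monsky's matrix (`s(n) = 1`) and a `4`-element kernel of the
Faulkner–James Laplacian of `G(−n)` give `BSD(E_n, 2)`, `n = p₀p₁p₂`, modulo ONLY the displayed journal
facts `h12` (TYZ Thm 1.2 AS PRINTED), `hGZK`, `hM`, `hR`.  NO `hgen`, NO L-value.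
[cite: TianYuanZhang2017, Thm. 1.2 (as printed) and §1 (1.1)] [cite: FaulknerJames2007, Thm. 1.2 (2)]
[cite: HeathBrown1994SelmerCongruentII, Appendix (Monsky)] [cite: Miller2011LMS, Def. 1.1 (arXiv:1010.2431 p. 3)] -/
theorem bsdp_two_congruentNumberCurve_of_card_ker_fj_three' (h12 : thm12_parity_of_scriptL')
    (hGZK : rank_eq_analyticRank_of_analyticRank_le_one) (hM : monsky_card_selmerGroup_two_odd)
    (hR : redeiReichardt_fourTwoCard_classGroup)
    (hp : ∀ i, (p i).Prime) (hinj : Function.Injective p) {n : ℕ} (hn : ∏ i, p i = n)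
    (h8 : n % 8 = 7) (L : Fin 3 → Fin 3 → ZMod 2) (d2 dm2 : Fin 3 → ZMod 2)
    (hL : ∀ i j, addLegendreSym (p j) (p i) = L i j) (h2 : ∀ i, addLegendreSym 2 (p i) = d2 i)
    (hm2 : ∀ i, addLegendreSym (-2) (p i) = dm2 i)
    (hkerM : Fintype.card {v : Fin 3 ⊕ Fin 3 → ZMod 2 // Matrix.fromBlocks
        (Matrix.of (fun i j => if i = j then ∑ l ∈ Finset.univ.erase i, L i l else L i j) +
          Matrix.diagonal d2) (Matrix.diagonal d2) (Matrix.diagonal d2)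
        (Matrix.of (fun i j => if i = j then ∑ l ∈ Finset.univ.erase i, L i l else L i j) +
          Matrix.diagonal dm2) *ᵥ v = 0} = 2)
    (hkerFJ : Fintype.card {v : Fin (3 + 1) → ZMod 2 // fjLaplacianNeg p *ᵥ v = 0} = 4) :
    BSDp (congruentNumberCurve n) 2 := by
  have hodd : ∀ i, Odd (p i) := fun i => (hp i).odd_of_ne_two (ne_two_of_prod_eq p hn h8 i)
  have h8' : (∏ i, p i) % 8 = 1 ∨ (∏ i, p i) % 8 = 7 := Or.inr (by rw [hn]; exact h8)
  exact bsdp_two_congruentNumberCurve_of_genus'' p h12 hGZK hM hp hodd hinj hn (Or.inr h8) L d2 dm2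
    hL h2 hm2 hkerM (rhoIndex_eq_one_of_card_ker p hp hinj h8' hkerFJ hn)
    (odd_genusSum_of_card_ker_fjLaplacianNeg_three' p hR hp hinj hn h8 hkerFJ)

end Assembly

end Summit.BirchSwinnertonDyer.Rank1Residual.P2
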